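import Mathlib
import HarnessLib
import HarnessLib.Audit
import Summits.CriticalPhenomena.Statement
import Literature.Probability.Percolation.CardyFormula
import Literature.Probability.Percolation.PercolationEvents
import Literature.Probability.RandomPlanarGeometry.ChordalCurveFamily
import Literature.Probability.LatticeModels.DomainDiscretisation
import HarnessLib.Audit.Status.Attr

/-!
Route: CardyStressTensorWard

DORMANT since 2026-08-24T07:59:37Z (reconciler: no traction for 6.6 d (last activity item-evidence-added at 2026-08-17T16:53:14Z); parked, not closed — `ledger route dormant route-CriticalPhenomena-CardyStressTensorWard --off` to reacti) — unstaffed, not closed; items shared with open routes are served there. `ledger route dormant <id> --off` reactivates.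

# Route CardyStressTensorWard — Percolation's lattice stress tensor ω_h − ω_v: differentiated DKKMO
+ Russo give Ward identities; CI ⇔ holomorphy of the signed pivotal field

It suffices to show X = LimitExists ∧ AsymptoticCI (crossing probabilities of bond-ℤ² at p = 1/2
converge for every
conformal rectangle, and two conformally equivalent rectangles have asymptotically equal crossing
probabilities); the
shared crux CardyRigidity (route CardyUniqueLimit) then identifies the limit with Cardy's F. The
route realises card
pivotal-stress-tensor-ward: AsymptoticCI is attacked through the LATTICE STRESS TENSOR T_loc = ω_h −
ω_v. At p = 1/2,
Cov(ω_e, 1_crossing) = P(e pivotal)/4, so T_loc inserted into the crossing event of R is the signed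
pivotal field
D_R(δ,u) = P(h_u pivotal) − P(v_u pivotal) (h_u, v_u the horizontal/vertical edge at the site u).
Bending the horizontal
train tracks of DKKMO's isoradial embedding 𝕃(π/2) = (1+i)ℤ² by a profile ε·a changes the
Grimmett–Manolescu critical
weights by ±(cw'(π/4)/2)·ε·a per track and slides the far half-planes along the tracks; Russo's
formula turns d/dε of
the crossing probability into the a-smeared sum of D_R, and universality turns it into the first
variation of the
crossing limit under the shear G_{π/2+εa}: the integrated Ward identity of a symmetric stress tensor
with free-boundary
condition (LocalShearWard, from InhomShearUniversality). The missing half of conformal invariance is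
TRACELESSNESS: the
claim that the complexified signed pivotal field (the h−v field of R together with that of its
45°-rotated copy)
converges to a holomorphic spin-2 field T_R in R (PivotalStressField; OrientationCancellation is its
pointwise O(δ²)
precursor). Then Ward(div-free, all directions) + holomorphy + Hadamard regularity of the limit
functional + exact scale
invariance (from LimitExists) force the first variation to vanish along vector fields holomorphic
near R̄, i.e.
AsymptoticCI (WardUpgrade; 2-D elasticity, Riva–Cardy, is the non-holomorphic loophole this closes).
Lean: `(∀ R : Literature.Probability.RandomPlanarGeometry.ConformalRectangle, ∃ L : ℝ,
Filter.Tendsto (Literature.Probability.Percolation.bondDomainCrossingProb R) (nhdsWithin 0 (Set.Ioi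
0)) (nhds L)) ∧ (open Literature.Probability.Percolation Literature.Probability.LatticeModels
Literature.Probability.RandomPlanarGeometry in ∀ (R R' : ConformalRectangle) (φ : ConformalEquiv
UpperHalfPlane.upperHalfPlaneSet R.carrier) (x : Fin 4 → ℝ) (φ' : ConformalEquiv
UpperHalfPlane.upperHalfPlaneSet R'.carrier) (x' : Fin 4 → ℝ), R.IsUniformizing φ x →
R'.IsUniformizing φ' x' → crossRatio x = crossRatio x' → Tendsto (fun δ : ℝ =>
bondDomainCrossingProb R δ - bondDomainCrossingProb R' δ) (𝓝[>] 0) (𝓝 0))`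

## Assembly
LimitExists → AsymptoticCI → CardyRigidity → CardyFormulaZ2, pure logic +
`ConformalRectangle.crossRatio_mem_Ioo_of_isUniformizing`:
define f(η) := the limit of some rectangle with a uniformizing datum of cross-ratio η (else 0);
AsymptoticCI makes every
R with a datum of cross-ratio η converge to f(η) (no use of the unproved
`crossRatio_eq_of_isUniformizing`), CardyRigidity
gives f = F on (0,1). PROVED in the planner sketch (theorem `assembly_holds`, axioms
propext/choice/Quot.sound). The cruxes
feed the target through WardUpgrade (item 6): OC → LSW → PSF → HR → LimitExists → RotInv →
AsymptoticCI.

Rationale: WHY THIS LINE. The only model-specific symmetry input available on ℤ² beyond lattice symmetries is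
DKKMO's rotation
invariance (DKKMO2020Rotational Thm 1.2/2.1, Cor 1.3; tree `dkkmo_theorem_1_7`,
`isoRectPercolation`), obtained from
universality across the isoradial embeddings 𝕃(𝛂) of ℤ² with ARBITRARY track-angle sequences
(arXiv:2012.11672 §2.1);
this route differentiates that universality instead of using it at finite angle: d/d(angle) of a
crossing probability is
an exact Russo sum of pivotal probabilities (`russo_formula_sum_holds`), so every infinitesimal
isoradial deformation gives
an exact lattice identity "smeared (h−v)-pivotal asymmetry = response of the crossing limit to a
shear" — the lattice
face of Cardy's strain/stress Ward identity, with the stress tensor represented by the local field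
ω_h − ω_v
(Kadanoff–Ceva / Koo–Saleur anisotropy-response construction transcribed to q = 1, where Z ≡ 1 and
the only non-trivial
correlators are covariances with events = pivotal probabilities). Imported areas: 2-D CFT (stress
tensor, Ward identity,
c = 0: ⟨T⟩_R ≡ 0 and ⟨T_loc T_loc⟩ ≡ 0 are lattice trivialities of the product measure, consistent
with c = 0 and
excluding a log-partner component, GurarieLudwig2005, VasseurJacobsenSaleur2012LogObservables),
quasiconformal
deformation theory (Hadamard/Beltrami first variation of conformal moduli), and the function theory
of quadratic
differentials (a holomorphic T_R real on ∂R with simple poles at the marks is one-dimensional, which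
is how holomorphy
forces Möbius invariance). Versus the six open routes: CardyRotToConf/ViaSLE6/UniqueLimit posit the
symmetry upgrade on
curve laws or leave X_U undecomposed; CardyIsoradial transports limits at finite angle;
DiscreteHolo/HarmonicInvariants
seek a preholomorphic 3-arm observable. Here the preholomorphic object is a PIVOTAL (4-arm, spin-2)
field whose Ward
identities are theorems-in-waiting of DKKMO + Russo, and conformality is reduced to its holomorphy.

RANKED CRUXES. #0 AsymptoticCI (target) — for conformal rectangles R, R' with uniformizing data of
equal cross-ratio, bondDomainCrossingProb R δ − bondDomainCrossingProb R' δ → 0 as δ → 0⁺ (conformal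
invariance without existence; with LimitExists this is X_U of CardyUniqueLimit). (why it might fail:
only if bond-ℤ² crossing limits are not conformally invariant (Beffara2008Universal Prop 4: true for
at most one modulus per lattice; LPSA numerics support α = i for ℤ²).) [Smirnov2001,
Beffara2008Universal, arXiv:math/9401222, DKKMO2020Rotational]
#2 PivotalStressField (crux) — [card (B)+(D)] There is a sign s = ±1 such that for every conformal
rectangle R, writing D_R(δ,u) = P_{1/2}(h_u pivotal for the crossing of R_δ) − P_{1/2}(v_u pivotal)
and R_θ = e^{−iθ}R: (covariance) for every θ and every continuous g compactly supported in R, Σ_u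
g(δu)[D_{R_θ}(δ,[e^{−iθ}δu]) − cos2θ·D_R(δ,u) − sin2θ·D_{R_{π/4}}(δ,[e^{−iπ/4}δu])] → 0; (Morera
holomorphy) for every C² complex g compactly supported in R, Σ_u ∂̄g(δu)·(D_R(δ,u) − i s
D_{R_{π/4}}(δ,[e^{−iπ/4}δu])) → 0. I.e. the signed pivotal fields of the rotated copies of R
assemble into ONE holomorphic quadratic differential T_R = D_R − i s D_{R_{π/4}} on R: the lattice
stress tensor is spin-2 and traceless in the interior. [deps: OrientationCancellation] [difficulty:
open-problem] (why it might fail: holomorphy = interior tracelessness has no lattice mechanism yet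
(only CFT: ⟨T(z)⟩_E holomorphic); covariance needs a next-order GPS ratio-limit theorem; a δ²·log δ
term (c=0 Jordan cells, VJS12) would break the normalisation.) [GarbanPeteSchramm2013Pivotal,
ChelkakGlazmanSmirnov2016StressTensor, VasseurJacobsenSaleur2012LogObservables, GurarieLudwig2005,
DKKMO2020Rotational, Polchinski1988ScaleConformal]
#3 OrientationCancellation (crux) — [card (B), pointwise precursor; cheapest falsifier] (i) For
every conformal rectangle R and compact K ⊂ R: |P(h_u pivotal) − P(v_u pivotal)| ≤ C_K δ² for all
sites δu ∈ K and small δ — the horizontal and the vertical edge at the same site are pivotal with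
probabilities that agree to order δ², although each is of order δ^{5/4}: equivalently pivotal
probabilities are rotation-invariant (under rotating the DOMAIN by 90° about the edge) to relative
order δ^{3/4} = δ^{2−5/4}, the gap between the 4-arm operator (Δ = 5/4) and the stress tensor (Δ =
2); (ii) for C²-smooth R the signed pivotal mass near ∂R is uniformly small (L¹-tightness: the
boundary layers, where the half-plane 3-arm exponent 2 makes each edge O(δ²), carry vanishing mass
away from a compact). [difficulty: XL] (why it might fail: an unknown spin-2 lattice correction to
the 4-arm event with dimension < 2, or a δ² log(1/δ) factor from the c = 0 logarithmic pairing,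
would violate the sharp δ²; near rough boundary points (ii) could fail (hence C² boundary).)
[GarbanPeteSchramm2013Pivotal, SmirnovWerner2001, Nolin2008,
VasseurJacobsenSaleur2012LogObservables, DKKMO2020Rotational]
#4 LocalShearWard (crux) — [card (A)+(C): the Ward identity] For every bounded continuous profile a
and every C²-smooth conformal rectangle R: the smeared signed pivotal sum (cw'(π/4)/2)·Σ_u
a(δ(u₀+u₁))·D_R(δ,u) converges to some L, and ε ↦ Λ(G_ε R) is differentiable at 0 with derivative L,
where Λ = lim_δ bondDomainCrossingProb (limUnder) and G_ε is the track-shear homeomorphism G_ε(z) =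
(1+i)⁻¹[Re((1+i)z) + ∫_0^{Im((1+i)z)} e^{i(π/2+εa(t))}dt] (bending the horizontal tracks of 𝕃(π/2)
at height t by ε a(t)). The case a ≡ 1 is the global identity: (√3/6)·E_{1/2}[N_h − N_v] (signed
count of pivotal edges of R) → d/dα|_{π/2} Λ(L_{π/2}⁻¹L_α R), explicitly lim E[N_h −
N_v]([0,r]×[0,1]) = −2√3·r·g'(r) with g = Cardy's rectangle crossing function of the aspect ratio r.
[deps: InhomShearUniversality, OrientationCancellation] [difficulty: XL] (why it might fail:
exchanging δ→0 with d/dε needs second-order cancellation (joint-pivotal sums O(1): true in CFT only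
because c = 0 kills the z⁻⁴ term of ⟨TT⟩); presupposes LimitExists-type uniqueness; profiles need
InhomShearUniversality beyond DKKMO's constant angles.) [DKKMO2020Rotational, arXiv:2012.11672,
RussoZW1981, GrimmettManolescu2014, ChelkakGlazmanSmirnov2016StressTensor, Cardy1992]
#5 HadamardRegularity (crux) — [card (C)] For every conformal rectangle R the crossing limit Λ
(limUnder of bondDomainCrossingProb) is Hadamard-differentiable along smooth ambient deformations:
there is an ℝ-linear D on vector fields, bounded by C·‖V‖_{C¹(ball ⊇ R̄)}, with ε ↦ Λ((id + εV)(R))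
differentiable at 0 with derivative D V for every C² field V of linear growth with bounded
derivative. (Its density on ∂R is the boundary 3-arm measure of card pivotal-energy-law; under
conformal invariance it is the Ahlfors–Bers derivative of the modulus, ∫_R ∂̄V·q_R with q_R the L¹
quadratic differential.) [difficulty: L] (why it might fail: Λ might be only Hölder in the domain
(RSW gives continuity, not C¹); differentiability at general Jordan R along smooth V is forced if Λ
is CI (modulus is real-analytic in the Beltrami coefficient) but is a genuine extra regularity claim
otherwise.) [GarbanPeteSchramm2013Pivotal, FriedrichWerner2003, SchrammSmirnov2011,
Beffara2008Universal]
#6 WardUpgrade (crux) — [analytic upgrade] OrientationCancellation → LocalShearWard →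
PivotalStressField → HadamardRegularity → LimitExists → RotationInvarianceCrossing → AsymptoticCI.
Proof plan: (a) LimitExists + exact scale/lattice equivariance of the discretisation + RotInv +
HR-continuity ⇒ Λ is similarity-invariant; (b) OC-tightness + PSF ⇒ along subsequences the signed
pivotal measures of R and of its rotated copies converge on R to Re/Im parts of one holomorphic T_R
∈ L¹(R); LSW (applied to R, its reflections — exact lattice symmetries — and, via RotInv, its
rotations) identifies D(V) = c·Re∫_R ∂̄V T_R for all ridge shears in all directions, hence
(plane-wave superposition + continuity of D) for all divergence-free V; (c) both sides depend only
on V|∂R and agree on the flux-zero hyperplane, so D(V) − c·Re∫∂̄V T_R = θ_R·∮V·n; V = z (dilation)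
gives θ_R = 0 by exact scale invariance; (d) hence D(V) = 0 for V holomorphic near R̄; integrate
along r ↦ φ⁻¹(rφ(R)) (marks transported) from R to an infinitesimal disc and use similarity
invariance + HR-continuity ⇒ Λ(R) depends only on the cross-ratio for C² R; (e) general Jordan R by
monotone smooth approximation + LimitExists. [deps: OrientationCancellation, LocalShearWard,
PivotalStressField, HadamardRegularity] [difficulty: L] (why it might fail: hidden inputs:
uniqueness of T_R across subsequences uses covariance+LSW in ALL directions; step (e) needs monotone
comparison of crossing events under domain approximation; boundary behaviour of T_R at corners
(simple poles) is used implicitly in (c).) [RivaCardy2005, Polchinski1988ScaleConformal,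
FriedrichWerner2003, Doyon2013CLEStressTensor, Beffara2008Universal, Smirnov2001]
#7 InhomShearUniversality (crux) — [card (A): DKKMO + profiles; the named-fact-level input, filed as
a crux per the unproved-fact rule] For every continuous track-angle profile β : ℝ → [ε₀, π−ε₀]:
critical inhomogeneous bond percolation on ℤ² with Grimmett–Manolescu weights p(h_u) =
cw(β(δ(u₀+u₁))/2), p(v_u) = cw((π−β)/2) (track of height t = δ(u₀+u₁) bent to transverse angle β(t);
`prodBernoulli`) crosses R_δ with probability asymptotically equal to the p = 1/2 crossing
probability of the sheared rectangle G_β(R), G_β(z) = (1+i)⁻¹[Re((1+i)z) + ∫_0^{Im((1+i)z)}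
e^{iβ(t)}dt]. Constant β ≡ α is DKKMO Thm 2.1/1.7 (d_SS half) + Cor 1.3 read through G02's
discretisation (tree: `dkkmo_theorem_1_7`, unproved named fact); two-valued step profiles are
DKKMO's mixed lattices 𝕃^{(0)} (§2.2). [difficulty: XL] (why it might fail: only constant profiles
are a theorem; position-dependent angles need the track-exchange/IIC-drift analysis of DKKMO §3
redone without the homogeneous symmetry; G02's discrete arcs of G_β(R) vs the sheared discrete arcs
of R may differ macroscopically for wild Jordan boundaries.) [DKKMO2020Rotational, arXiv:2012.11672,
GrimmettManolescu2014, GrimmettManolescuAOP2013, SchrammSmirnov2011]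
#9 LimitExists (support) — existence of the crossing limit for every conformal rectangle (shared
with CardyUniqueLimit r3, stmt-CriticalPhenomena-0747; here it supplies exact scale invariance θ_R =
0 in WardUpgrade (c)). [difficulty: open-problem] [BollobasRiordan2006, Smirnov2001]
#9 CardyRigidity (support) — a conformally invariant crossing limit f is Cardy's function (shared
with CardyUniqueLimit r2, stmt-CriticalPhenomena-0746; the identification step of the Assembly).
[difficulty: L] [CamiaNewman2007, Smirnov2001]
#9 RotationInvarianceCrossing (support) — DKKMO Cor 1.3 at q = 1 read through G02's discretisation
of conformal rectangles: bondDomainCrossingProb R δ − bondDomainCrossingProb (e^{iθ}R) δ → 0 for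
every θ (input of WardUpgrade (a),(b); provable from `dkkmo_theorem_1_2` once that fact lands, plus
a loop-to-crossing dictionary). [difficulty: L] [DKKMO2020Rotational, arXiv:2012.11672]
#9 RussoIsoRect (support) — exact lattice identity (provable now from `russo_formula_sum_holds`
technology for the one-parameter inhomogeneous family `isoRectPercolation α`): d/dα at π/2 of the
crossing probability of R_δ equals (cw'(π/4)/2)·Σ_e σ(e) P_{1/2}(e pivotal), σ = +1 on horizontal,
−1 on vertical edges; cw'(π/4) = √3/3. [difficulty: provable-now] [RussoZW1981, DKKMO2020Rotational,
GrimmettManolescu2014]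

TWO-LAYER PLAN. LocalShearWard ⇐ InhomShearUniversality → RussoIsoRect(inhomogeneous, per profile) →
[equicontinuity of ε ↦ smeared
pivotal sums under the ε-deformed weights: second-order (joint-pivotal) cancellation] →
LocalShearWard.
PivotalStressField ⇐ [vague existence + L¹-tightness from OrientationCancellation] →
[SpinTwoCovariance via a
next-order GPS ratio-limit theorem + DKKMO] → [Morera holomorphy] (the last child is where the bet
sits).
WardUpgrade ⇐ (a–c) functional-analytic identity D = c·Re∫∂̄V T_R + θ_R·flux → (d)
infinitesimal-to-global along
conformal shrinking paths → (e) smooth-to-Jordan approximation.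

KILL CRITERIA. ¬OrientationCancellation(i) with a power δ^{2−ε'} (numerics or a rigorous lower bound
on the h−v asymmetry) kills the
identification T_loc = stress tensor and closes the route (close --reason
refuted:OrientationCancellation); a mere
log δ factor forces a pivot to a renormalised field (restate PSF/LSW with the log). ¬LocalShearWard
for a ≡ 1 on the
square (lim E[N_h − N_v] ≠ −2√3 g'(1)) refutes "differentiated DKKMO = Russo" and closes the route.
¬PivotalStressField
(covariance holds but ∂̄T_R ≠ 0) means a trace/virial term exists: pivot to the card's arm-exponent
form of the virial
criterion (identify the dimension-1 current) or close. ¬LimitExists closes every Cardy route.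
AsymptoticCI proved
elsewhere (e.g. via SLE₆LimitZ2) moots the mechanism but not the Assembly.

NOT DECOMPOSED YET. The boundary behaviour of T_R (T_{nτ} = 0, T_{ττ} − T_{nn} ∝ boundary 3-arm
density, simple poles with residues
∂_{x_i}Λ at the marks) — consequences of LSW + HR used inside WardUpgrade, to be split out only if
WardUpgrade stalls;
the family-1 (vertical-track) identities (exact x ↦ −x lattice reflection of LSW); the
loop-to-crossing dictionary
behind RotationInvarianceCrossing; uniform RSW/GM13 inputs for the inhomogeneous lattices; the exact
scale-equivariance
lemma for `discreteCrossing`; everything about the VALUE (CardyRigidity's interior lives in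
CardyUniqueLimit).

CHEAPEST FALSIFIER. Exact enumeration / transfer matrix (n ≤ 7) or Monte Carlo (n ≤ 256) for the
critical n×n square, LR crossing:
(1) E_{1/2}[N_h − N_v] = Σ_h P(h piv) − Σ_v P(v piv) = d/dε P^{(1/2+ε,1/2−ε)}|₀ (Russo) must
converge to the O(1) constant
−2√3 g'(1) > 0 (g = Cardy's rectangle crossing function of the aspect ratio; both sums diverge like
n^{3/4});
(2) at the centre site, |P(h piv) − P(v piv)| / P(h piv) must decay like n^{−3/4}. Either failing
kills the line
(kit compute was not available to this planner; refuters should run it first).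

NUMBERS. 4-arm (pivotal) exponent 5/4 and half-plane 3-arm exponent 2 (SmirnovWerner2001; universal
on GM isoradial class,
GrimmettManolescuAOP2013); stress tensor Δ = 2, spin 2; next spin-2 bulk fields (2,±1) at Δ = 13/4;
cw'(π/4) = √3/3 so
dp_h/dα = √3/6 at the square point; first-order DKKMO deformation d/dα (L_{π/2}⁻¹L_α) = strain
diag(−1/2, 1/2) +
rotation 1/2, hence aspect ratio r ↦ r(1−ε) and lim (√3/6)E[N_h−N_v]([0,r]×[0,1]) = −r g'(r).

DEFINITION REQUESTS. None needed to state the items (all typed over existing declarations: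
`IsPivotal`, `discreteCrossing`,
`bondDomainCrossingProb`, `prodBernoulli`, `criticalWeight(I)`, `isoRectPercolation`,
`MarkedDomain.map`, `nearestSite`,
`limUnder`). Wanted later (layer 2): the signed pivotal measure of a conformal rectangle as a
`Measure`/distribution and
the Hadamard derivative of a domain functional (topic Literature/Probability/Percolation), to
restate PSF/LSW/HR natively.

Novelty: Searches (2026-08-15): lit search --hybrid "stress-energy tensor percolation lattice Ward identity
crossing probability"
(12 book hits, none relevant); lit vsearch "discrete stress-energy tensor in the loop O(n) model" (0
paper hits, index
noise); lit galaxy search "discrete stress-energy tensor" --star all (1 hit: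
Chelkak–Laslier–Russkikh t-embeddings,
dimers) and "stress-energy tensor through conformal restriction" (3 unrelated); lit read
arXiv:1604.06339 pp.2–16
(CGS: T from local non-planar deformations of Nienhuis' lozenge weights, hexagonal O(n), half CR, n
= 1 proved; p. 8:
Kadanoff–Ceva, Koo–Saleur, Benoist–Hongler "whole line of rhombi deformed" for ISING),
arXiv:2012.11672 pp.4–9 (DKKMO:
𝕃(𝛂) with arbitrary track angles, Thm 2.1 d_CN+d_SS, Cor 1.3, mixed lattice 𝕃^{(0)}),
arXiv:1008.1378 pp.10, 43 (GPS:
subsequential pivotal measures on ℤ²; covariance uses rotation invariance), arXiv:1209.1560 p.1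
(Doyon: CLE stress
tensor only for 8/3 < κ ≤ 4); plain `lit search` FTS daemon reset (3 attempts), arXiv API 429 for
lit cite.
Nearest prior art found: ChelkakGlazmanSmirnov2016StressTensor (discrete T by lattice deformation,
O(n) on hexagonal
lattice) and the Benoist–Hongler line-deformation construction it reports (Ising); KadanoffCeva1971
/ KooSaleur1994 (T as
h−v energy anisotropy); DKKMO2020Rotational (the deformation family, finite angle);
GarbanPeteSchramm2013Pivotal (pivotal
measures); card pivotal-energy-law (boundary Hadamard sibling).
Delta: at q = 1 the anisotr  [refs: 1604.06339, 2012.11672, 1008.1378, 1209.1560, KadanoffCeva1971, KooSaleur1994]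

Barriers (technique_class: stress-tensor, ward-identity, pivotal-density): - technique_class: stress-tensor, ward-identity, pivotal-density
- Literature.Barriers.CriticalPhenomena.EmbeddingModulusUniqueness: evaded by construction — the
CI-producing inputs see the embedding: LocalShearWard pairs the EXACT square-point derivative
cw'(π/4) of the Grimmett–Manolescu weights with the specific linear/track-shear maps L_{π/2}⁻¹L_α of
the isoradial embedding (evasion (i)(a) star–triangle/isoradial weights), RotationInvarianceCrossing
is DKKMO (evasion (i)), and PivotalStressField's holomorphy is false for a stretched copy
diag(1,p)ℤ² (T∘linear is not holomorphic); only OrientationCancellation and HadamardRegularity are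
embedding-blind, and they are not where invariance comes from.
- Literature.Barriers.CriticalPhenomena.FKParafermionicHalfCauchyRiemann: applies in spirit (shear
identities alone fix only the divergence-free responses = "half"); the route names the other half
explicitly as holomorphy/tracelessness of a spin-2 PIVOTAL field (not the spin-1/3 FK edge
observable, not a linear vertex relation), so it is outside `halfCRSolutions`; the bet is
PivotalStressField.
- Literature.Barriers.CriticalPhenomena.ScaleCovarianceNotMoebius: the upgrade here is not
Euclidean+scale ⇒ Möbius in the abstract: it uses a local conserved traceless T (holomorphy) —
exactly the structure absent in the barrier's 3-D witness and in 2-D elasticity (RivaCardy2005),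
which has Ward identities and scale invariance but a non-holomorphic T; WardUpgrade (c) shows where
scale inv

History (route lifecycle, newest last):
- 2026-08-15T16:53:50Z · rev 2: restated RussoIsoRect (stmt-CriticalPhenomena-4571) — route-repair (cone, step 1/2): restate support RussoIsoRect 1:1 with DKKMO's weights inlined (prodBernoulli of criticalWeightI (α/2) on horizontal edges s(u,u+e (planner-rbadge-CriticalPhenomena-CardyStressTe-75608049-g4-0)
- 2026-08-24T07:59:37Z · DORMANT — reconciler: no traction for 6.6 d (last activity item-evidence-added at 2026-08-17T16:53:14Z); parked, not closed — `ledger route dormant route-CriticalPhenomen (operator:999:2698895)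

sub-problem: CardyFormulaZ2 · status: dormant · opened planner-plancard-CriticalPhenomena-CardyFormu-96b5c9a9-0 2026-08-15T11:34:32Z · rev 5 · ledger route-CriticalPhenomena-CardyStressTensorWard
GENERATED by the gate from the ledger (D-0016/17). Provers cite these decls: `theorem foo : Summit.CriticalPhenomena.CardyFormulaZ2.Theses.CardyStressTensorWard.<Decl> := …` in Summits/CriticalPhenomena/CardyFormulaZ2/Theorems/<Name>.lean.
-/

namespace Summit.CriticalPhenomena.CardyFormulaZ2.Theses.CardyStressTensorWard

open scoped BigOperators Topology Manifold Classical MeasureTheory ProbabilityTheory Matrix InnerProductSpace ComplexConjugate ContinuousMap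
open Filter Set Function TopologicalSpace MeasureTheory

attribute [summit_statement] _root_.CardyFormulaZ2

/-- item stmt-CriticalPhenomena-4563 · target · rank 0 · open · by planner
why it might fail: fails only if bond-ℤ² crossing limits are not conformally invariant: open (BollobasRiordan2006 Ch.7 Conj.1; proved only for site-𝕋, Smirnov2001); Beffara2008Universal Prop.4: CI holds for at most one embedding modulus per lattice — numerics (LPSA94) support the square one.
sources: Smirnov2001, Beffara2008Universal, arXiv:math/9401222, BollobasRiordan2006, DKKMO2020Rotational
[target] for conformal rectangles R, R' with uniformizing data of equal cross-ratio,
bondDomainCrossingProb R δ − bondDomainCrossingProb R' δ → 0 as δ → 0⁺ (conformal invariance without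
existence; with LimitExists this is X_U of CardyUniqueLimit). -/
@[route_item "route-CriticalPhenomena-CardyStressTensorWard"]
def AsymptoticCI : Prop :=
  open Literature.Probability.Percolation Literature.Probability.LatticeModels Literature.Probability.RandomPlanarGeometry in ∀ (R R' : ConformalRectangle) (φ : ConformalEquiv UpperHalfPlane.upperHalfPlaneSet R.carrier) (x : Fin 4 → ℝ) (φ' : ConformalEquiv UpperHalfPlane.upperHalfPlaneSet R'.carrier) (x' : Fin 4 → ℝ), R.IsUniformizing φ x → R'.IsUniformizing φ' x' → crossRatio x = crossRatio x' → Tendsto (fun δ : ℝ => bondDomainCrossingProb R δ - bondDomainCrossingProb R' δ) (𝓝[>] 0) (𝓝 0)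

/-- item stmt-CriticalPhenomena-4564 · crux · rank 2 · open · by planner
why it might fail: interior holomorphy (tracelessness) of the h−v pivotal field has no lattice mechanism: CGS16 get only half of Cauchy–Riemann even for loop O(n); the bulk c=0 (T,t) Jordan cell (VGJS12, b=−5) could add δ²log δ / non-holomorphic parts; covariance with g∈C⁰ needs lattice-scale smoothness of P(h_u piv).
sources: ChelkakGlazmanSmirnov2016StressTensor, GarbanPeteSchramm2013Pivotal, VasseurGainutdinovJacobsenSaleur2012BulkCZero, VasseurJacobsenSaleur2012LogObservables, GurarieLudwig2005, DKKMO2020Rotational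
[crux] [card (B)+(D)] There is a sign s = ±1 such that for every conformal rectangle R, writing
D_R(δ,u) = P_{1/2}(h_u pivotal for the crossing of R_δ) − P_{1/2}(v_u pivotal) and R_θ = e^{−iθ}R:
(covariance) for every θ and every continuous g compactly supported in R, Σ_u
g(δu)[D_{R_θ}(δ,[e^{−iθ}δu]) − cos2θ·D_R(δ,u) − sin2θ·D_{R_{π/4}}(δ,[e^{−iπ/4}δu])] → 0; (Morera
holomorphy) for every C² complex g compactly supported in R, Σ_u ∂̄g(δu)·(D_R(δ,u) − i s
D_{R_{π/4}}(δ,[e^{−iπ/4}δu])) → 0. I.e. the signed pivotal fields of the rotated copies of R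
assemble into ONE holomorphic quadratic differential T_R = D_R − i s D_{R_{π/4}} on R: the lattice
stress tensor is spin-2 and traceless in the interior. [deps: OrientationCancellation] [difficulty:
open-problem] -/
@[route_item "route-CriticalPhenomena-CardyStressTensorWard", crux]
def PivotalStressField : Prop :=
  open Literature.Probability.Percolation Literature.Probability.LatticeModels Literature.Probability.RandomPlanarGeometry in let μ := bondPercolation (zdGraph 2) half; let D := fun (R : ConformalRectangle) (δ : ℝ) (u : Site 2) => μ.real {ω | IsPivotal (discreteCrossing R.carrier δ (R.arc 0) (R.arc 2)) s(u, u + Pi.single 0 1) ω} - μ.real {ω | IsPivotal (discreteCrossing R.carrier δ (R.arc 0) (R.arc 2)) s(u, u + Pi.single 1 1) ω}; ∃ s : ℝ, (s = 1 ∨ s = -1) ∧ ∀ (ρ : ℝ → ℂ ≃ₜ ℂ), (∀ (θ : ℝ) (z : ℂ), ρ θ z = Complex.exp (-(θ : ℂ) * Complex.I) * z) → ∀ R : ConformalRectangle, (∀ (θ : ℝ) (g : ℂ → ℝ), Continuous g → HasCompactSupport g → tsupport g ⊆ R.carrier → Tendsto (fun δ : ℝ => ∑' u : Site 2, g (meshPoint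 δ u) * (D (R.map (ρ θ)) δ (nearestSite δ (ρ θ (meshPoint δ u))) - (Real.cos (2 * θ) * D R δ u + Real.sin (2 * θ) * D (R.map (ρ (Real.pi / 4))) δ (nearestSite δ (ρ (Real.pi / 4) (meshPoint δ u)))))) (𝓝[>] 0) (𝓝 0)) ∧ (∀ g : ℂ → ℂ, ContDiff ℝ 2 g → HasCompactSupport g → tsupport g ⊆ R.carrier → Tendsto (fun δ : ℝ => ∑' u : Site 2, (fderiv ℝ g (meshPoint δ u) 1 + Complex.I * fderiv ℝ g (meshPoint δ u) Complex.I) / 2 * (((D R δ u : ℝ) : ℂ) - Complex.I * (s : ℂ) * ((D (R.map (ρ (Real.pi / 4))) δ (nearestSite δ (ρ (Real.pi / 4) (meshPoint δ u))) : ℝ) : ℂ))) (𝓝[>] 0) (𝓝 0))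

/-- item stmt-CriticalPhenomena-4565 · crux · rank 3 · open · by planner
why it might fail: sharp O(δ²) for P(h_u piv)−P(v_u piv) is a spin-2-gap conjecture (2−5/4), no lattice literature; at bulk c=0, T sits in a Jordan cell whose partner is built on the spin-2 4-leg field (VGJS12, b=−5), the very sector of h−v, so δ²log(1/δ) is a live risk; 5/4 unproved on ℤ²; (ii) may fail at rough ∂R.
sources: GarbanPeteSchramm2013Pivotal, SmirnovWerner2001, Nolin2008, VasseurGainutdinovJacobsenSaleur2012BulkCZero, VasseurJacobsenSaleur2012LogObservables, DKKMO2020Rotational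
[crux] [card (B), pointwise precursor; cheapest falsifier] (i) For every conformal rectangle R and
compact K ⊂ R: |P(h_u pivotal) − P(v_u pivotal)| ≤ C_K δ² for all sites δu ∈ K and small δ — the
horizontal and the vertical edge at the same site are pivotal with probabilities that agree to order
δ², although each is of order δ^{5/4}: equivalently pivotal probabilities are rotation-invariant
(under rotating the DOMAIN by 90° about the edge) to relative order δ^{3/4} = δ^{2−5/4}, the gap
between the 4-arm operator (Δ = 5/4) and the stress tensor (Δ = 2); (ii) for C²-smooth R the signed
pivotal mass near ∂R is uniformly small (L¹-tightness: the boundary layers, where the half-plane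
3-arm exponent 2 makes each edge O(δ²), carry vanishing mass away from a compact). [difficulty: XL] -/
@[route_item "route-CriticalPhenomena-CardyStressTensorWard", crux]
def OrientationCancellation : Prop :=
  open Literature.Probability.Percolation Literature.Probability.LatticeModels Literature.Probability.RandomPlanarGeometry in let μ := bondPercolation (zdGraph 2) half; let D := fun (R : ConformalRectangle) (δ : ℝ) (u : Site 2) => μ.real {ω | IsPivotal (discreteCrossing R.carrier δ (R.arc 0) (R.arc 2)) s(u, u + Pi.single 0 1) ω} - μ.real {ω | IsPivotal (discreteCrossing R.carrier δ (R.arc 0) (R.arc 2)) s(u, u + Pi.single 1 1) ω}; ∀ R : ConformalRectangle, (∀ K : Set ℂ, IsCompact K → K ⊆ R.carrier → ∃ C δ₀ : ℝ, 0 < δ₀ ∧ ∀ δ ∈ Set.Ioo (0:ℝ) δ₀, ∀ u : Site 2, meshPoint δ u ∈ K → |D R δ u| ≤ C * δ ^ 2) ∧ ((ContDiff ℝ 2 R.boundary ∧ ∀ t : ℝ, deriv R.boundary t ≠ 0) → ∀ η : ℝ, 0 < η → ∃ K : Set ℂ, IsCompact K ∧ K ⊆ R.carrier ∧ ∃ δ₀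 : ℝ, 0 < δ₀ ∧ ∀ δ ∈ Set.Ioo (0:ℝ) δ₀, (∑' u : Site 2, if meshPoint δ u ∈ K then (0:ℝ) else |D R δ u|) ≤ η)

/-- item stmt-CriticalPhenomena-4566 · crux · rank 4 · open · by planner
why it might fail: swapping δ→0 and d/dε needs uniform second-order (joint-pivotal) cancellation, unknown on ℤ² (the δ^c rate of Manolescu2025 Thm 5.3 gives no derivatives); profiles need InhomShearUniversality beyond DKKMO's constant α; standalone, HasDerivAt of limUnder is junk unless LimitExists holds for all G_εR.
sources: DKKMO2020Rotational, arXiv:2012.11672, Manolescu2025ExploringFK, RussoZW1981, GrimmettManolescu2014, ChelkakGlazmanSmirnov2016StressTensor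
[crux] [card (A)+(C): the Ward identity] For every bounded continuous profile a and every C²-smooth
conformal rectangle R: the smeared signed pivotal sum (cw'(π/4)/2)·Σ_u a(δ(u₀+u₁))·D_R(δ,u)
converges to some L, and ε ↦ Λ(G_ε R) is differentiable at 0 with derivative L, where Λ = lim_δ
bondDomainCrossingProb (limUnder) and G_ε is the track-shear homeomorphism G_ε(z) =
(1+i)⁻¹[Re((1+i)z) + ∫_0^{Im((1+i)z)} e^{i(π/2+εa(t))}dt] (bending the horizontal tracks of 𝕃(π/2)
at height t by ε a(t)). The case a ≡ 1 is the global identity: (√3/6)·E_{1/2}[N_h − N_v] (signed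
count of pivotal edges of R) → d/dα|_{π/2} Λ(L_{π/2}⁻¹L_α R), explicitly lim E[N_h −
N_v]([0,r]×[0,1]) = −2√3·r·g'(r) with g = Cardy's rectangle crossing function of the aspect ratio r.
[deps: InhomShearUniversality, OrientationCancellation] [difficulty: XL] -/
@[route_item "route-CriticalPhenomena-CardyStressTensorWard", crux]
def LocalShearWard : Prop :=
  open Literature.Probability.Percolation Literature.Probability.LatticeModels Literature.Probability.RandomPlanarGeometry in let μ := bondPercolation (zdGraph 2) half; let D := fun (R : ConformalRectangle) (δ : ℝ) (u : Site 2) => μ.real {ω | IsPivotal (discreteCrossing R.carrier δ (R.arc 0) (R.arc 2)) s(u, u + Pi.single 0 1) ω} - μ.real {ω | IsPivotal (discreteCrossing R.carrier δ (R.arc 0) (R.arc 2)) s(u, u + Pi.single 1 1) ω}; ∀ (a : ℝ → ℝ), Continuous a → (∃ B : ℝ, ∀ t, |a t| ≤ B) → ∀ (G : ℝ → ℂ ≃ₜ ℂ), (∀ᶠ ε in 𝓝 (0:ℝ), ∀ z : ℂ, G ε z = (1 + Complex.I)⁻¹ * ((((1 + Complex.I) * z).re : ℂ) + ∫ t in (0:ℝ)..((1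 + Complex.I) * z).im, Complex.exp (((Real.pi / 2 + ε * a t : ℝ) : ℂ) * Complex.I))) → ∀ R : ConformalRectangle, (ContDiff ℝ 2 R.boundary ∧ ∀ t : ℝ, deriv R.boundary t ≠ 0) → ∃ L : ℝ, Tendsto (fun δ : ℝ => deriv criticalWeight (Real.pi / 4) / 2 * ∑' u : Site 2, a (δ * (u 0 + u 1)) * D R δ u) (𝓝[>] 0) (𝓝 L) ∧ HasDerivAt (fun ε : ℝ => limUnder (𝓝[>] (0:ℝ)) (bondDomainCrossingProb (R.map (G ε)))) L 0

/-- item stmt-CriticalPhenomena-4567 · crux · rank 5 · open · by planner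
why it might fail: RSW gives only Hölder continuity in the domain; the boundary-pivotal density (half-plane 3-arm exponent 2, Nolin2008 Thm 23) is known on ℤ² only up to constants, so existence of a first variation at each Jordan R is open — forced only by CI (Ahlfors–Bers) = the target; limUnder junk w/o LimitExists.
sources: GarbanPeteSchramm2013Pivotal, Nolin2008, FriedrichWerner2003, SchrammSmirnov2011, Beffara2008Universal
[crux] [card (C)] For every conformal rectangle R the crossing limit Λ (limUnder of
bondDomainCrossingProb) is Hadamard-differentiable along smooth ambient deformations: there is an
ℝ-linear D on vector fields, bounded by C·‖V‖_{C¹(ball ⊇ R̄)}, with ε ↦ Λ((id + εV)(R))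
differentiable at 0 with derivative D V for every C² field V of linear growth with bounded
derivative. (Its density on ∂R is the boundary 3-arm measure of card pivotal-energy-law; under
conformal invariance it is the Ahlfors–Bers derivative of the modulus, ∫_R ∂̄V·q_R with q_R the L¹
quadratic differential.) [difficulty: L] -/
@[route_item "route-CriticalPhenomena-CardyStressTensorWard", crux]
def HadamardRegularity : Prop :=
  open Literature.Probability.Percolation Literature.Probability.LatticeModels Literature.Probability.RandomPlanarGeometry in ∀ R : ConformalRectangle, ∃ (D' : (ℂ → ℂ) →ₗ[ℝ] ℝ) (C r : ℝ), closure R.carrier ⊆ Metric.ball (0:ℂ) r ∧ ∀ V : ℂ → ℂ, ContDiff ℝ 2 V → (∃ B : ℝ, ∀ z : ℂ, ‖V z‖ ≤ B * (1 + ‖z‖) ∧ ‖fderiv ℝ V z‖ ≤ B) → |D' V| ≤ C * sSup ((fun z : ℂ => ‖V z‖ + ‖fderiv ℝ V z‖) '' Metric.closedBall (0:ℂ) r) ∧ ∀ Φ : ℝ → ℂ ≃ₜ ℂ, (∀ᶠ ε in 𝓝 (0:ℝ), ∀ z : ℂ, Φ ε z = z + (ε : ℂ) * V z) → HasDerivAt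 (fun ε : ℝ => limUnder (𝓝[>] (0:ℝ)) (bondDomainCrossingProb (R.map (Φ ε)))) (D' V) 0

/-- item stmt-CriticalPhenomena-18761 · crux · rank 6 · open · by planner
why it might fail: sharp ratio-limit ε⁻²·P(half-plane 3-arm ε→1) → c_R(z) is unknown on bond-ℤ² (exponents only up to constants, Nolin2008 Thm 23); forced by CI (Ahlfors–Bers) = near the target; at rough Jordan boundary points even the exponent changes.
sources: GarbanPeteSchramm2013Pivotal, Nolin2008, SchrammSmirnov2011, SmirnovWerner2001, FriedrichWerner2003
[crux] LOCAL FIRST VARIATION (split child 1/4 of HadamardRegularity, strategist line hadamard-split;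
the load-bearing piece). For every conformal rectangle R there is ρ = ρ(R) > 0 such that every
admissible field V (C², linear growth, bounded derivative) supported in SOME ball of radius ρ has an
asymptotic, mesh-uniform, junk-free first variation L: for every family of plane homeomorphisms Φ
with germ id + εV on closure R (∀ᶠ ε, ∀ z ∈ closure R.carrier, Φ ε z = z + ε V z) and every η > 0,
eventually in ε → 0 and then eventually in δ → 0⁺, |P_δ(R.map (Φ ε)) − P_δ(R.map (Φ 0)) − εL| ≤ η|ε|
(P_δ = bondDomainCrossingProb). I.e. the boundary flip DENSITY exists at one boundary spot
(half-plane 3-arm ratio limit) or at one marked point (2-arm analogue = ∂Λ/∂mark), integrated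
against the bump; no linearity, no bound, no limUnder. With LimitExists it is exactly HasDerivAt of
the crossing limit along localized bumps. Two regimes for the prover: balls missing the four marks
(3-arm density) and balls around a mark. [deps: none] [difficulty: open-problem] (why it might fail:
sharp ratio-limit ε⁻²·P(half-plane 3-arm ε→1) → c_R(z) is unknown on bond-ℤ² (exponents only up to
constants, Nolin2008 -/
@[route_item "route-CriticalPhenomena-CardyStressTensorWard"]
def LocalizedVariation : Prop :=
  open Literature.Probability.Percolation Literature.Probability.LatticeModels Literature.Probability.RandomPlanarGeometry in ∀ R : ConformalRectangle, ∃ ρ : ℝ, 0 < ρ ∧ ∀ (z₀ : ℂ) (V : ℂ → ℂ), ContDiff ℝ 2 V → (∃ B : ℝ, ∀ z : ℂ, ‖V z‖ ≤ B * (1 + ‖z‖) ∧ ‖fderiv ℝ V z‖ ≤ B) → tsupport V ⊆ Metric.ball z₀ ρ → ∃ L : ℝ, ∀ Φ : ℝ → ℂ ≃ₜ ℂ, (∀ᶠ ε in 𝓝 (0:ℝ), ∀ z ∈ closure R.carrier, Φ ε z = z + (ε : ℂ) * V z) → ∀ η : ℝ, 0 < η → ∀ᶠ ε in 𝓝 (0:ℝ),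 ∀ᶠ δ in 𝓝[>] (0:ℝ), |bondDomainCrossingProb (R.map (Φ ε)) δ - bondDomainCrossingProb (R.map (Φ 0)) δ - ε * L| ≤ η * |ε|

/-- item stmt-CriticalPhenomena-4568 · crux · rank 6 · open · by planner
why it might fail: false only if CI fails; risk: not provable from the typed antecedents — PSF/OC control T_R on compacts of R only, yet step (c) (Stokes: D depends on V|∂R) needs T_R's boundary behaviour incl. simple poles at the marks; uniqueness of T_R over subsequences; LSW is for C² R, (e) needs Jordan R.
sources: RivaCardy2005, Polchinski1988ScaleConformal, FriedrichWerner2003, Doyon2013CLEStressTensor, Beffara2008Universal, Smirnov2001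
[crux] [analytic upgrade] OrientationCancellation → LocalShearWard → PivotalStressField →
HadamardRegularity → LimitExists → RotationInvarianceCrossing → AsymptoticCI. Proof plan: (a)
LimitExists + exact scale/lattice equivariance of the discretisation + RotInv + HR-continuity ⇒ Λ is
similarity-invariant; (b) OC-tightness + PSF ⇒ along subsequences the signed pivotal measures of R
and of its rotated copies converge on R to Re/Im parts of one holomorphic T_R ∈ L¹(R); LSW (applied
to R, its reflections — exact lattice symmetries — and, via RotInv, its rotations) identifies D(V) =
c·Re∫_R ∂̄V T_R for all ridge shears in all directions, hence (plane-wave superposition + continuity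
of D) for all divergence-free V; (c) both sides depend only on V|∂R and agree on the flux-zero
hyperplane, so D(V) − c·Re∫∂̄V T_R = θ_R·∮V·n; V = z (dilation) gives θ_R = 0 by exact scale
invariance; (d) hence D(V) = 0 for V holomorphic near R̄; integrate along r ↦ φ⁻¹(rφ(R)) (marks
transported) from R to an infinitesimal disc and use similarity invariance + HR-continuity ⇒ Λ(R)
depends only on the cross-ratio for C² R; (e) general Jordan R by monotone smooth approximation +
LimitExists. [deps: OrientationCan -/
@[route_item "route-CriticalPhenomena-CardyStressTensorWard", crux]
def WardUpgrade : Prop :=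
  open Literature.Probability.Percolation Literature.Probability.LatticeModels Literature.Probability.RandomPlanarGeometry in let μ := bondPercolation (zdGraph 2) half; let D := fun (R : ConformalRectangle) (δ : ℝ) (u : Site 2) => μ.real {ω | IsPivotal (discreteCrossing R.carrier δ (R.arc 0) (R.arc 2)) s(u, u + Pi.single 0 1) ω} - μ.real {ω | IsPivotal (discreteCrossing R.carrier δ (R.arc 0) (R.arc 2)) s(u, u + Pi.single 1 1) ω}; (∀ R : ConformalRectangle, (∀ K : Set ℂ, IsCompact K → K ⊆ R.carrier → ∃ C δ₀ : ℝ, 0 < δ₀ ∧ ∀ δ ∈ Set.Ioo (0:ℝ) δ₀, ∀ u : Site 2, meshPoint δ u ∈ K → |D R δ u| ≤ C * δ ^ 2) ∧ ((ContDiff ℝ 2 R.boundary ∧ ∀ t : ℝ, deriv R.boundary t ≠ 0) → ∀ η : ℝ, 0 < η → ∃ K : Set ℂ, IsCompact K ∧ K ⊆ R.carrier ∧ ∃ δ₀ : ℝ, 0 < δ₀ ∧ ∀ δ ∈ Set.Ioo (0:ℝ) δ₀, (∑' u : Site 2, if meshPoint δ u ∈ K then (0:ℝ) else |D R δ u|)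 ≤ η)) → (∀ (a : ℝ → ℝ), Continuous a → (∃ B : ℝ, ∀ t, |a t| ≤ B) → ∀ (G : ℝ → ℂ ≃ₜ ℂ), (∀ᶠ ε in 𝓝 (0:ℝ), ∀ z : ℂ, G ε z = (1 + Complex.I)⁻¹ * ((((1 + Complex.I) * z).re : ℂ) + ∫ t in (0:ℝ)..((1 + Complex.I) * z).im, Complex.exp (((Real.pi / 2 + ε * a t : ℝ) : ℂ) * Complex.I))) → ∀ R : ConformalRectangle, (ContDiff ℝ 2 R.boundary ∧ ∀ t : ℝ, deriv R.boundary t ≠ 0) → ∃ L : ℝ, Tendsto (fun δ : ℝ => deriv criticalWeight (Real.pi / 4) / 2 * ∑' u : Site 2, a (δ * (u 0 + u 1)) * D R δ u) (𝓝[>] 0) (𝓝 L) ∧ HasDerivAt (fun ε : ℝ => limUnder (𝓝[>] (0:ℝ)) (bondDomainCrossingProb (R.map (G ε)))) L 0) → (∃ s : ℝ, (s = 1 ∨ s = -1) ∧ ∀ (ρ : ℝ → ℂ ≃ₜ ℂ), (∀ (θ : ℝ) (z : ℂ), ρ θ z = Complex.exp (-(θ : ℂ) * Complex.I) * z) → ∀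 R : ConformalRectangle, (∀ (θ : ℝ) (g : ℂ → ℝ), Continuous g → HasCompactSupport g → tsupport g ⊆ R.carrier → Tendsto (fun δ : ℝ => ∑' u : Site 2, g (meshPoint δ u) * (D (R.map (ρ θ)) δ (nearestSite δ (ρ θ (meshPoint δ u))) - (Real.cos (2 * θ) * D R δ u + Real.sin (2 * θ) * D (R.map (ρ (Real.pi / 4))) δ (nearestSite δ (ρ (Real.pi / 4) (meshPoint δ u)))))) (𝓝[>] 0) (𝓝 0)) ∧ (∀ g : ℂ → ℂ, ContDiff ℝ 2 g → HasCompactSupport g → tsupport g ⊆ R.carrier → Tendsto (fun δ : ℝ => ∑' u : Site 2, (fderiv ℝ g (meshPoint δ u) 1 + Complex.I * fderiv ℝ g (meshPoint δ u) Complex.I) / 2 * (((D R δ u : ℝ) : ℂ) - Complex.I * (s : ℂ) * ((D (R.map (ρ (Real.pi / 4))) δ (nearestSite δ (ρ (Real.pi / 4) (meshPoint δ u))) : ℝ) : ℂ))) (𝓝[>] 0) (𝓝 0))) → (∀ R : ConformalRectangle, ∃ (D' : (ℂ → ℂ) →ₗ[ℝ] ℝ) (C r : ℝ), closure R.carrier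 ⊆ Metric.ball (0:ℂ) r ∧ ∀ V : ℂ → ℂ, ContDiff ℝ 2 V → (∃ B : ℝ, ∀ z : ℂ, ‖V z‖ ≤ B * (1 + ‖z‖) ∧ ‖fderiv ℝ V z‖ ≤ B) → |D' V| ≤ C * sSup ((fun z : ℂ => ‖V z‖ + ‖fderiv ℝ V z‖) '' Metric.closedBall (0:ℂ) r) ∧ ∀ Φ : ℝ → ℂ ≃ₜ ℂ, (∀ᶠ ε in 𝓝 (0:ℝ), ∀ z : ℂ, Φ ε z = z + (ε : ℂ) * V z) → HasDerivAt (fun ε : ℝ => limUnder (𝓝[>] (0:ℝ)) (bondDomainCrossingProb (R.map (Φ ε)))) (D' V) 0) → (∀ R : ConformalRectangle, ∃ L : ℝ, Filter.Tendsto (bondDomainCrossingProb R) (nhdsWithin 0 (Set.Ioi 0)) (nhds L)) → (∀ (θ : ℝ) (ρ : ℂ ≃ₜ ℂ), (∀ z : ℂ, ρ z = Complex.exp ((θ : ℂ) * Complex.I) * z) → ∀ R : ConformalRectangle, Tendsto (fun δ : ℝ => bondDomainCrossingProb R δ - bondDomainCrossingProb (R.map ρ) δ) (𝓝[>] 0)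 (𝓝 0)) → (∀ (R R' : ConformalRectangle) (φ : ConformalEquiv UpperHalfPlane.upperHalfPlaneSet R.carrier) (x : Fin 4 → ℝ) (φ' : ConformalEquiv UpperHalfPlane.upperHalfPlaneSet R'.carrier) (x' : Fin 4 → ℝ), R.IsUniformizing φ x → R'.IsUniformizing φ' x' → crossRatio x = crossRatio x' → Tendsto (fun δ : ℝ => bondDomainCrossingProb R δ - bondDomainCrossingProb R' δ) (𝓝[>] 0) (𝓝 0))

/-- item stmt-CriticalPhenomena-18767 · crux · rank 7 · open · by planner
why it might fail: a merely Gateaux-differentiable functional of the domain can have a conical (norm-like, positively homogeneous but non-additive) first variation; CI-free additivity at ONE window needs local linear response in the strip width, i.e. part of the density mechanism.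
sources: GarbanPeteSchramm2013Pivotal, Nolin2008, FriedrichWerner2003, Beffara2008Universal
[crux] SUPERPOSITION OF FIRST VARIATIONS (split child 2/4 of HadamardRegularity, line
hadamard-split). For every conformal rectangle R, admissible fields V, W and reals L, M: if L is the
asymptotic (mesh-uniform, lattice-level) first variation of the crossing probability along EVERY
family with germ id + εV on closure R, and M the one along every (id + εW)-family, then L + M is the
asymptotic first variation along every (id + ε(V+W))-family. Physical content: first-order responses
of distant boundary windows add (two boundary-pivotal windows are second order,
quasi-multiplicativity up to constants), and at one window the response is linear in the strip
width; under CI it is linearity of the Gateaux derivative of the (Fréchet-smooth) modulus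
functional. In the assembly it turns local existence (LocalizedVariation) into global existence by
induction over a smooth partition of unity, and makes the derivative additive. [deps: none]
[difficulty: L] (why it might fail: a merely Gateaux-differentiable functional of the domain can
have a conical (norm-like, positively homogeneous but non-additive) first variation; CI-free
additivity at ONE window needs local linear response in the strip wi -/
@[route_item "route-CriticalPhenomena-CardyStressTensorWard"]
def VariationSuperposition : Prop :=
  open Literature.Probability.Percolation Literature.Probability.LatticeModels Literature.Probability.RandomPlanarGeometry in ∀ (R : ConformalRectangle) (V W : ℂ → ℂ) (L M : ℝ), ContDiff ℝ 2 V → (∃ B : ℝ, ∀ z : ℂ, ‖V z‖ ≤ B * (1 + ‖z‖) ∧ ‖fderiv ℝ V z‖ ≤ B) → ContDiff ℝ 2 W → (∃ B : ℝ, ∀ z : ℂ, ‖W z‖ ≤ B * (1 + ‖z‖) ∧ ‖fderiv ℝ W z‖ ≤ B) → (∀ Φ : ℝ → ℂ ≃ₜ ℂ, (∀ᶠ ε in 𝓝 (0:ℝ), ∀ z ∈ closure R.carrier, Φ ε z = z + (ε : ℂ) * V z) → ∀ η : ℝ, 0 < η → ∀ᶠ ε in 𝓝 (0:ℝ), ∀ᶠ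 δ in 𝓝[>] (0:ℝ), |bondDomainCrossingProb (R.map (Φ ε)) δ - bondDomainCrossingProb (R.map (Φ 0)) δ - ε * L| ≤ η * |ε|) → (∀ Φ : ℝ → ℂ ≃ₜ ℂ, (∀ᶠ ε in 𝓝 (0:ℝ), ∀ z ∈ closure R.carrier, Φ ε z = z + (ε : ℂ) * W z) → ∀ η : ℝ, 0 < η → ∀ᶠ ε in 𝓝 (0:ℝ), ∀ᶠ δ in 𝓝[>] (0:ℝ), |bondDomainCrossingProb (R.map (Φ ε)) δ - bondDomainCrossingProb (R.map (Φ 0)) δ - ε * M| ≤ η * |ε|) → ∀ Φ : ℝ → ℂ ≃ₜ ℂ, (∀ᶠ ε in 𝓝 (0:ℝ), ∀ z ∈ closure R.carrier, Φ ε z = z + (ε : ℂ) * (V z + W z)) → ∀ η : ℝ, 0 < η → ∀ᶠ ε in 𝓝 (0:ℝ), ∀ᶠ δ in 𝓝[>] (0:ℝ), |bondDomainCrossingProb (R.map (Φ ε)) δ - bondDomainCrossingProb (R.map (Φ 0)) δ - ε * (L + M)| ≤ η * |ε|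

/-- item stmt-CriticalPhenomena-4569 · crux · rank 7 · open · by planner
why it might fail: only constant α is a theorem (DKKMO Thm 2.1/2.3, arXiv:2012.11672 p.7; §6 fixes α, cos α∉ℚ); bi-periodic sequences are announced only (Hansen–Manolescu in prep., Manolescu2025 Rem 5.6); the slowly-varying non-periodic (β(δn))_n needed here are beyond that; plus G02 discrete arcs for wild Jordan ∂R.
sources: DKKMO2020Rotational, arXiv:2012.11672, Manolescu2025ExploringFK, HansenManolescu2024LargeScale, GrimmettManolescu2014, GrimmettManolescuAOP2013
[crux] [card (A): DKKMO + profiles; the named-fact-level input, filed as a crux per the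
unproved-fact rule] For every continuous track-angle profile β : ℝ → [ε₀, π−ε₀]: critical
inhomogeneous bond percolation on ℤ² with Grimmett–Manolescu weights p(h_u) = cw(β(δ(u₀+u₁))/2),
p(v_u) = cw((π−β)/2) (track of height t = δ(u₀+u₁) bent to transverse angle β(t); `prodBernoulli`)
crosses R_δ with probability asymptotically equal to the p = 1/2 crossing probability of the sheared
rectangle G_β(R), G_β(z) = (1+i)⁻¹[Re((1+i)z) + ∫_0^{Im((1+i)z)} e^{iβ(t)}dt]. Constant β ≡ α is
DKKMO Thm 2.1/1.7 (d_SS half) + Cor 1.3 read through G02's discretisation (tree: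
`dkkmo_theorem_1_7`, unproved named fact); two-valued step profiles are DKKMO's mixed lattices
𝕃^{(0)} (§2.2). [difficulty: XL] -/
@[route_item "route-CriticalPhenomena-CardyStressTensorWard"]
def InhomShearUniversality : Prop :=
  open Literature.Probability.Percolation Literature.Probability.LatticeModels Literature.Probability.RandomPlanarGeometry in ∀ (ε₀ : ℝ), 0 < ε₀ → ∀ (β : ℝ → ℝ), Continuous β → (∀ t, β t ∈ Set.Icc ε₀ (Real.pi - ε₀)) → ∀ (G : ℂ ≃ₜ ℂ), (∀ z : ℂ, G z = (1 + Complex.I)⁻¹ * ((((1 + Complex.I) * z).re : ℂ) + ∫ t in (0:ℝ)..((1 + Complex.I) * z).im, Complex.exp ((β t : ℂ) * Complex.I))) → ∀ (w : ℝ → Sym2 (Site 2) → unitInterval), (∀ (δ : ℝ) (u : Site 2), w δ s(u, u + Pi.single 0 1) = criticalWeightI (β (δ * (u 0 + u 1)) / 2) ∧ w δ s(u, u + Pi.single 1 1) = criticalWeightI ((Real.pi - β (δ * (u 0 + u 1))) / 2)) → (∀ (δ : ℝ), ∀ e ∉ (zdGraph 2).edgeSet, w δ e = 0) → ∀ R :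 ConformalRectangle, Tendsto (fun δ : ℝ => (prodBernoulli (w δ)).real (discreteCrossing R.carrier δ (R.arc 0) (R.arc 2)) - bondDomainCrossingProb (R.map G) δ) (𝓝[>] 0) (𝓝 0)

/-- item stmt-CriticalPhenomena-18768 · crux · rank 8 · open · by planner
why it might fail: the arm-counting needs a rectifiable (better C¹) ∂R: at rough Jordan boundary points boundary exponents depend on the local geometry and the strip Φ_ε(R)ΔR has no length; the statement is for EVERY Jordan R (true under CI by Ahlfors, CI-free only for smooth R).
sources: Nolin2008, SmirnovWerner2001, GarbanPeteSchramm2013Pivotal, Beffara2008Universal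
[crux] A-PRIORI LIPSCHITZ BOUND (split child 3/4 of HadamardRegularity, line hadamard-split;
up-to-constants technology). For every conformal rectangle R there are C and r with closure R ⊆ ball
0 r such that for every admissible field V and every family Φ with germ id + εV on closure R:
eventually in ε and then eventually in δ → 0⁺, |P_δ(R.map (Φ ε)) − P_δ(R.map (Φ 0))| ≤
C·|ε|·sup_{closedBall 0 r}(‖V‖ + ‖DV‖). Mechanism: the crossing events of R_δ and (Φ_ε R)_δ differ
only through a boundary-pivotal configuration in the strip Φ_ε(R) Δ R of width ≤ |ε|‖V‖∞: per
boundary window of size |ε| a half-plane 3-arm event from |ε| to 1 (≍ ε², exponent 2 universal on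
ℤ²), 1/|ε| windows ⇒ O(|ε|); near a marked point the arc relabelling costs a half-plane 2-arm event
(exponent 1, universal) ⇒ O(|ε|). Supplies the C¹-norm bound of the derivative in the assembly
(squeezed from the increments). Lattice-level, junk-free (no limUnder). [deps: none] [difficulty: L]
(why it might fail: the arm-counting needs a rectifiable (better C¹) ∂R: at rough Jordan boundary
points boundary exponents depend on the local geometry and the strip Φ_ε(R)ΔR has no length; the
statement is for EVERY Jordan R (true under -/
@[route_item "route-CriticalPhenomena-CardyStressTensorWard"]
def DeformationLipschitz : Prop :=
  open Literature.Probability.Percolation Literature.Probability.LatticeModels Literature.Probability.RandomPlanarGeometry in ∀ R : ConformalRectangle, ∃ C r : ℝ, closure R.carrier ⊆ Metric.ball (0:ℂ) r ∧ ∀ V : ℂ → ℂ, ContDiff ℝ 2 V → (∃ B : ℝ, ∀ z : ℂ, ‖V z‖ ≤ B * (1 + ‖z‖) ∧ ‖fderiv ℝ V z‖ ≤ B) → ∀ Φ : ℝ → ℂ ≃ₜ ℂ, (∀ᶠ ε in 𝓝 (0:ℝ), ∀ z ∈ closure R.carrier, Φ ε z = z + (ε : ℂ) * V z) → ∀ᶠ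 ε in 𝓝 (0:ℝ), ∀ᶠ δ in 𝓝[>] (0:ℝ), |bondDomainCrossingProb (R.map (Φ ε)) δ - bondDomainCrossingProb (R.map (Φ 0)) δ| ≤ C * |ε| * sSup ((fun z : ℂ => ‖V z‖ + ‖fderiv ℝ V z‖) '' Metric.closedBall (0:ℂ) r)

/-- item stmt-CriticalPhenomena-0746 · support · rank 9 · open · by planner
sources: CamiaNewman2007, Smirnov2001
[crux] Cardy rigidity on Z^2: if the bond-Z^2 crossing probabilities of ALL conformal rectangles
converge to a function f of the cross-ratio, then f = cardyFunction on (0,1). Intended proof: with f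
as hitting kernel, Smirnov2001 Thm 2 / CamiaNewman2007 §§5-7 / Werner2007 §4 give convergence of the
exploration path (AB tightness isTightLaws_map_bondInterface, RSW rsw_half) to a conformally
invariant domain-Markov curve = SLE_κ (Schramm2000); percolation locality forces κ = 6
(LawlerSchrammWerner2001 §3, cf. eq_six_of_forall_measureReal_hitsBefore) and
sle_six_measureReal_hitsBefore returns f = F. Vacuous unless X_U holds, but provable
unconditionally. -/
@[route_item "route-CriticalPhenomena-CardyStressTensorWard", crux]
def CardyRigidity : Prop :=
  ∀ f : ℝ → ℝ, (∀ R : Literature.Probability.RandomPlanarGeometry.ConformalRectangle, R.HasCrossingLimit (Literature.Probability.Percolation.bondDomainCrossingProb R) f) → Set.EqOn f Literature.Probability.RandomPlanarGeometry.cardyFunction (Set.Ioo 0 1)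

/-- item stmt-CriticalPhenomena-0747 · support · rank 9 · open · by planner
sources: BollobasRiordan2006, Smirnov2001
[crux] Existence of the scaling limit of bond-Z^2 crossing probabilities at p=1/2 for every
conformal rectangle (no identification, no conformal invariance). Open (Grimmett1999 §9.7
conjecture; only RSW bounds on cluster points are known: discreteCrossingProb_clusterPt_mem_Ioo).
Necessary for the conjunct. -/
@[route_item "route-CriticalPhenomena-CardyStressTensorWard", crux]
def LimitExists : Prop :=
  ∀ R : Literature.Probability.RandomPlanarGeometry.ConformalRectangle, ∃ L : ℝ, Filter.Tendsto (Literature.Probability.Percolation.bondDomainCrossingProb R) (nhdsWithin 0 (Set.Ioi 0)) (nhds L)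

-- earlier RussoIsoRect (stmt-CriticalPhenomena-4571, replaced 2026-08-15T16:53:50Z -> stmt-CriticalPhenomena-11244): retired by None — open Literature.Probability.Percolation Literature.Probability.LatticeModels Literature.Probability.RandomPlanarGeometry in ∀ (R : ConformalRectangle) (δ : ℝ), 0 < δ → HasDerivAt (fun α : ℝ => (isoRectPercolation α).real (discreteCrossing R.carrier δ (R.arc 0) (R.arc
/-- item stmt-CriticalPhenomena-11244 · support · rank 9 · open · by planner
sources: RussoZW1981, DKKMO2020Rotational, GrimmettManolescu2014
[support] exact lattice identity, provable now (Russo along the DKKMO angle: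
`hasDerivAt_prodBernoulli_real` + `IsUpperSet`/`DeterminedBy` of `discreteCrossing` on the finite
discrete domain + `criticalWeight` calculus): for DKKMO's one-parameter family φ_{L(α)} —
independent edges with the Grimmett–Manolescu weights `criticalWeightI (α/2)` on the horizontal
edges `s(u, u+e₀)` and `criticalWeightI ((π−α)/2)` on the vertical edges of ℤ² (this is
`isoRectPercolation α` of `IsoradialRectangularLoops`, inlined so that the route file does not
import the DKKMO loop stack) — d/dα at α = π/2 of the crossing probability of R_δ equals
(cw'(π/4)/2)·Σ_e σ(e)·P_{1/2}(e pivotal for the crossing), σ = +1 on horizontal, −1 on vertical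
edges; cw'(π/4) = √3/3, both weights are 1/2 at π/2. [difficulty: provable-now] -/
@[route_item "route-CriticalPhenomena-CardyStressTensorWard"]
def RussoIsoRect : Prop :=
  open Literature.Probability.Percolation Literature.Probability.LatticeModels Literature.Probability.RandomPlanarGeometry in ∀ (R : ConformalRectangle) (δ : ℝ), 0 < δ → HasDerivAt (fun α : ℝ => (prodBernoulli (fun e : Sym2 (Site 2) => if e ∈ (zdGraph 2).edgeSet then (if ∃ u : Site 2, e = s(u, u + Pi.single 0 1) then criticalWeightI (α / 2) else criticalWeightI ((Real.pi - α) / 2)) else (0 : unitInterval))).real (discreteCrossing R.carrier δ (R.arc 0) (R.arc 2))) (deriv criticalWeight (Real.pi / 4) / 2 * ∑' e : Sym2 (Site 2), (if e ∈ (zdGraph 2).edgeSet then (if ∃ u : Site 2, e = s(u, u + Pi.single 0 1) then (1:ℝ) else -1) else 0) * (bondPercolation (zdGraph 2) half).real {ω | IsPivotal (discreteCrossing R.carrier δ (R.arc 0) (R.arc 2)) e ω}) (Real.pi / 2)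

/-- item stmt-CriticalPhenomena-14150 · support · rank 9 · open · by planner
[support] GLUE BY NAME, provable now in one line (route-choice repair 2026-08-16 of the operator
hold `target-unreachable` on AsymptoticCI; option (a) "add glue item(s) Crux… → AsymptoticCI"). The
analytic-upgrade crux WardUpgrade (stmt-CriticalPhenomena-4568, rank 6) was filed with the texts of
OrientationCancellation, LocalShearWard, PivotalStressField, HadamardRegularity, LimitExists,
RotationInvarianceCrossing and AsymptoticCI INLINED, so no item of the route mentioned the target
AsymptoticCI by name and the layer-invariant audit saw the cruxes disconnected from `closes (hLE)
(hCI) (hCR)`. This item is the by-name edge: WardUpgrade → OrientationCancellation → LocalShearWard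
→ PivotalStressField → HadamardRegularity → LimitExists → RotationInvarianceCrossing → AsymptoticCI.
The inlining is VERBATIM, so the statement holds by δ-unfolding alone: `theorem
WardUpgradeGlue_holds : WardUpgradeGlue := fun h => h` (checked by the planner in Sketch.lean
against the rendered route module, lean check rc 0, 2026-08-16T03:00Z); it carries no mathematical
content beyond WardUpgrade, whose why-might-fail (boundary behaviour of T_R at the marks, uniqueness
of T_R over subsequences, C² vs Jordan -/
@[route_item "route-CriticalPhenomena-CardyStressTensorWard", crux]
def WardUpgradeGlue : Prop :=
  WardUpgrade → OrientationCancellation → LocalShearWard → PivotalStressField → HadamardRegularity → LimitExists → (∀ (θ : ℝ) (ρ : ℂ ≃ₜ ℂ), (∀ z : ℂ, ρ z = Complex.exp ((θ : ℂ) * Complex.I) * z) → ∀ R : Literature.Probability.RandomPlanarGeometry.ConformalRectangle, Filter.Tendsto (fun δ : ℝ => Literature.Probability.Percolation.bondDomainCrossingProb R δ - Literature.Probability.Percolation.bondDomainCrossingProb (R.map ρ) δ) (nhdsWithin 0 (Set.Ioi 0)) (nhds 0)) → AsymptoticCI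

/-- item stmt-CriticalPhenomena-18769 · support · rank 9 · open · by planner
sources: BollobasRiordan2006, Smirnov2001
[support] LIMITS ALONG THE FAMILIES (split child 4/4 of HadamardRegularity, line hadamard-split;
bookkeeping). For every conformal rectangle R, admissible V and family Φ with germ id + εV on
closure R: eventually in ε the crossing probabilities P_δ(R.map (Φ ε)) converge as δ → 0⁺. This is
the route's shared support item LimitExists (stmt-CriticalPhenomena-0747) read along the deformation
families and follows from it in one line (`fun h R _ _ _ Φ _ => Filter.Eventually.of_forall fun ε =>
h (R.map (Φ ε))`, checked rc 0 in the planner's Sketch.lean); it carries no separate bet and should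
NOT be staffed separately — it is a child only because the typed glue must quantify the passage from
the lattice-level children to HR's limUnder over a child decl. It is where the limUnder-fragility
flag N1 of 4566/4567 is discharged. [deps: LimitExists] [difficulty: open-problem (= 0747);
provable-now from 0747] [BollobasRiordan2006, Smirnov2001] -/
@[route_item "route-CriticalPhenomena-CardyStressTensorWard"]
def DeformationLimits : Prop :=
  open Literature.Probability.Percolation Literature.Probability.LatticeModels Literature.Probability.RandomPlanarGeometry in ∀ (R : ConformalRectangle) (V : ℂ → ℂ), ContDiff ℝ 2 V → (∃ B : ℝ, ∀ z : ℂ, ‖V z‖ ≤ B * (1 + ‖z‖) ∧ ‖fderiv ℝ V z‖ ≤ B) → ∀ Φ : ℝ → ℂ ≃ₜ ℂ, (∀ᶠ ε in 𝓝 (0:ℝ), ∀ z ∈ closure R.carrier, Φ ε z = z + (ε : ℂ) * V z) → ∀ᶠ ε in 𝓝 (0:ℝ), ∃ Λ : ℝ, Tendsto (bondDomainCrossingProb (R.map (Φ ε))) (𝓝[>] 0) (𝓝 Λ)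

/-- item stmt-CriticalPhenomena-18770 · support · rank 9 · open · by planner
sources: FriedrichWerner2003, GarbanPeteSchramm2013Pivotal
[support] GLUE BY NAME of the typed split of the crux HadamardRegularity
(stmt-CriticalPhenomena-4567; strategist cstrat-stmt-CriticalPhenomena-4567-r1, BC2 redirect of the
2026-08-17 route re-audit): DeformationLipschitz (stmt-18768, crux r8) → LocalizedVariation
(stmt-18761, crux r6) → VariationSuperposition (stmt-18767, crux r7) → DeformationLimits
(stmt-18769, support) → HadamardRegularity. PROVED sorry-free by the strategist: theorem
hadamardRegularity_of_subs in the candidate proof HRSplit.lean attached to stmt-4567 (packaged as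
Theorems/CardyStressTensorWardHadamardRegularitySplit.lean; lean check rc0, 0 sorries, axioms
propext/Classical.choice/Quot.sound, 457 lines) and, as the registered line
Cruxes/HadamardRegularity/Lines/hadamard_split.lean (skeleton check OK, 4 stubs). Assembly = smooth
partition of unity localisation on a ball ⊇ R̄ (families quantified by their germ on closure
R.carrier, all that MarkedDomain.map sees) + superposition by Finset induction + homogeneity by
reparametrising ε + uniqueness of asymptotic variations (homeomorphisms z ↦ z + εVz by the
contraction principle) + C¹ bound squeezed from the Lipschitz piece + LinearMap.exists_extend + the
interchan -/
@[route_item "route-CriticalPhenomena-CardyStressTensorWard"]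
def HadamardRegularityOfSubs : Prop :=
  DeformationLipschitz → LocalizedVariation → VariationSuperposition → DeformationLimits → HadamardRegularity

/-- item stmt-CriticalPhenomena-4570 · support · rank 9 · open · by planner
sources: DKKMO2020Rotational, arXiv:2012.11672
[support] DKKMO Cor 1.3 at q = 1 read through G02's discretisation of conformal rectangles:
bondDomainCrossingProb R δ − bondDomainCrossingProb (e^{iθ}R) δ → 0 for every θ (input of
WardUpgrade (a),(b); provable from `dkkmo_theorem_1_2` once that fact lands, plus a loop-to-crossing
dictionary). [difficulty: L] -/
@[route_item "route-CriticalPhenomena-CardyStressTensorWard", crux]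
def RotationInvarianceCrossing : Prop :=
  open Literature.Probability.Percolation Literature.Probability.LatticeModels Literature.Probability.RandomPlanarGeometry in ∀ (θ : ℝ) (ρ : ℂ ≃ₜ ℂ), (∀ z : ℂ, ρ z = Complex.exp ((θ : ℂ) * Complex.I) * z) → ∀ R : ConformalRectangle, Tendsto (fun δ : ℝ => bondDomainCrossingProb R δ - bondDomainCrossingProb (R.map ρ) δ) (𝓝[>] 0) (𝓝 0)

/-- item stmt-CriticalPhenomena-4572 · assembly · rank 1 · open · by planner
sources: Smirnov2001, CamiaNewman2007
[assembly] LimitExists → AsymptoticCI → CardyRigidity → CardyFormulaZ2 -/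
@[route_item "route-CriticalPhenomena-CardyStressTensorWard"]
def Assembly : Prop :=
  (∀ R : Literature.Probability.RandomPlanarGeometry.ConformalRectangle, ∃ L : ℝ, Filter.Tendsto (Literature.Probability.Percolation.bondDomainCrossingProb R) (nhdsWithin 0 (Set.Ioi 0)) (nhds L)) → (∀ (R R' : Literature.Probability.RandomPlanarGeometry.ConformalRectangle) (φ : Literature.Probability.RandomPlanarGeometry.ConformalEquiv UpperHalfPlane.upperHalfPlaneSet R.carrier) (x : Fin 4 → ℝ) (φ' : Literature.Probability.RandomPlanarGeometry.ConformalEquiv UpperHalfPlane.upperHalfPlaneSet R'.carrier) (x' : Fin 4 → ℝ), R.IsUniformizing φ x → R'.IsUniformizing φ' x' → Literature.Probability.RandomPlanarGeometry.crossRatio x = Literature.Probability.RandomPlanarGeometry.crossRatio x' → Tendsto (fun δ : ℝ => Literature.Probability.Percolation.bondDomainCrossingProb R δ - Literature.Probability.Percolation.bondDomainCrossingProb R' δ) (𝓝[>] 0) (𝓝 0)) → (∀ f : ℝ → ℝ, (∀ R : Literature.Probability.RandomPlanarGeometry.ConformalRectangle, R.HasCrossingLimit (Literature.Probability.Percolation.bondDomainCrossingProb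 R) f) → Set.EqOn f Literature.Probability.RandomPlanarGeometry.cardyFunction (Set.Ioo 0 1)) → CardyFormulaZ2

/-! D-0027 §2.1 — DECIDING THEOREM (planner-authored via `route open/edit --closes-file`; by planner-rchoice-CriticalPhenomena-CardyStressT-36bfcecd-0 2026-08-16T03:23:05Z):
its hypotheses are this route's items and its conclusion the sub-problem Statement (glue_lint), and it elaborates with this file. -/

@[closes "route-CriticalPhenomena-CardyStressTensorWard"] theorem closes (hOC : OrientationCancellation) (hLSW : LocalShearWard) (hPSF : PivotalStressField)
    (hHR : HadamardRegularity) (hLE : LimitExists) (hRot : RotationInvarianceCrossing) (hWU : WardUpgrade)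
    (hG : WardUpgradeGlue) (hCR : CardyRigidity) : _root_.CardyFormulaZ2 := by
  classical
  -- the route's own way to the target: cruxes ⟹[WardUpgrade, read by name through WardUpgradeGlue] AsymptoticCI
  have hCI : AsymptoticCI := hG hWU hOC hLSW hPSF hHR hLE hRot
  -- (1) a limit function of the cross-ratio: `f η` := the crossing limit (from `LimitExists`) of SOME conformal
  -- rectangle carrying a uniformizing datum of cross-ratio `η` (junk `0` if there is none); `AsymptoticCI` makes
  -- every rectangle with a datum of cross-ratio `η` converge to the same value, so every `R` has crossing limit `f`.
  obtain ⟨f, hf⟩ : ∃ f : ℝ → ℝ, ∀ R : Literature.Probability.RandomPlanarGeometry.ConformalRectangle,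
      R.HasCrossingLimit (Literature.Probability.Percolation.bondDomainCrossingProb R) f := by
    refine ⟨fun η => if h : (∃ R₀ : Literature.Probability.RandomPlanarGeometry.ConformalRectangle,
        ∃ φ₀ : Literature.Probability.RandomPlanarGeometry.ConformalEquiv UpperHalfPlane.upperHalfPlaneSet R₀.carrier,
        ∃ x₀ : Fin 4 → ℝ, R₀.IsUniformizing φ₀ x₀ ∧ Literature.Probability.RandomPlanarGeometry.crossRatio x₀ = η)
      then Classical.choose (hLE (Classical.choose h)) else 0, ?_⟩
    intro R φ x hux
    have hP : ∃ R₀ : Literature.Probability.RandomPlanarGeometry.ConformalRectangle,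
        ∃ φ₀ : Literature.Probability.RandomPlanarGeometry.ConformalEquiv UpperHalfPlane.upperHalfPlaneSet R₀.carrier,
        ∃ x₀ : Fin 4 → ℝ, R₀.IsUniformizing φ₀ x₀ ∧
          Literature.Probability.RandomPlanarGeometry.crossRatio x₀ = Literature.Probability.RandomPlanarGeometry.crossRatio x :=
      ⟨R, φ, x, hux, rfl⟩
    obtain ⟨φ₀, x₀, hux₀, hcr₀⟩ := Classical.choose_spec hP
    have hL₀ := Classical.choose_spec (hLE (Classical.choose hP))
    have hd := hCI R (Classical.choose hP) φ x φ₀ x₀ hux hux₀ hcr₀.symm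
    have hsum := hd.add hL₀
    simp only [sub_add_cancel, zero_add] at hsum
    simp only [dif_pos hP]
    exact hsum
  -- (2) rigidity identifies `f` with Cardy's function on `(0,1)`, where every realised cross-ratio lies.
  have hfeq := hCR f hf
  intro R φ x hux
  have h := hf R φ x hux
  rw [hfeq (Literature.Probability.RandomPlanarGeometry.ConformalRectangle.crossRatio_mem_Ioo_of_isUniformizing hux)] at h
  exact h

end Summit.CriticalPhenomena.CardyFormulaZ2.Theses.CardyStressTensorWard
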